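import Mathlib
import HarnessLib
import HarnessLib.Audit
import Summits.NavierStokesRegularity.Statement
import Summits.NavierStokesRegularity.NavierStokesRegularity.Theses.RootDecompTerminalEnergy
import Literature.Analysis.FluidPDE.ClassicalSolution
import Literature.Analysis.FluidPDE.LerayHopf
import Literature.Analysis.FluidPDE.SuitableWeak
import Literature.Analysis.FluidPDE.VectorCalculus
import Literature.Analysis.FluidPDE.BlowupAncientSolution
import Literature.Analysis.FluidPDE.SelfSimilar
import Summits.NavierStokesRegularity.NavierStokesRegularity.Theorems.NoBlowupToClay
import Summits.NavierStokesRegularity.NavierStokesRegularity.Theorems.ContinuousAlignmentContinuousAlignmentCriterionStubUnidirectionalLiouville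
import Literature.Analysis.FluidPDE.NSCriticalClosureHolds
import Literature.Analysis.FluidPDE.SelfSimilarLiouville
import Literature.Analysis.FluidPDE.KNSSNoAxisymmetricTypeIHolds
import HarnessLib.Audit.Status.Attr

/-!
Route: RootDecompAlignedCore

# Route RootDecompAlignedCore — Root decomposition g2 under N1 — Clay (A) ⟸ no energy atom ∧
coherent paced cores extend (D₁, attackable) ∧ tame wild-core blow-up is Type I (E₂″) ∧ atom-free ⟹
tame ∧ no Type I — AlignedCoreDichotomy

ROOT DECOMPOSITION CELL decomp-ns (D-0178/D-0179, RESIDUAL MODE, blocker-first), generation 2 node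
booked by route-writer decomp-ns-writer-1 (g2):
the critic-CLEARED lens-2 (g2) node AlignedCoreDichotomy («structural dichotomy: special vs
generic», RESIDUAL MODE on N1's residual E₂ =
RootDecompTerminalEnergy.NoTameTypeII stmt-24828; CRITIC-LEDGER rows 25/27, CLEARED rev1, no
objection; lens file HOME/decomp-ns-lens-2/AlignedCoreDichotomy.lean
sha256 d47fcf4c8a5cd78b0e511fc0fd5084cc4c591eafd3609a3a3e003e666654a94f, 445 lines, lean rc 0 / 0
sorry / 0 warnings, kernel `closes` (5 binders), `noTameTypeII_iff_cells`
(E₂ ⟺ C₁ ∧ E₂″ EXACT, excluded middle on «coherent core»), `coherentPacedExtends_of_alignedPaceZoom`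
(PZ ⟹ D₁ over the LANDED unidirectional ancient Liouville
theorem `Theorems.stub_unidirectionalLiouville` = stmt-1923 and the PROVED bounded continuation
`hasSmoothExtensionPast_of_bounded_holds`), `alignedPaceZoom_iff_stub`
(PZ = registered stub `stub_paceZoom` of line `pace` of crux 18584, Iff.rfl), `node_iff`; census
data file of record HOME/census/COSTUME-CENSUS-v2.json sha256
05830338dcd56dc85a60276b05d4c6d88311c06479f2f16e07487067c2455ac6, HOME/census/CASCADE-THRESHOLD.md
sha256 245123b9f388229f5703ee18f8f186a2cace4b21bfd44018154f82efe5904e10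
(census §8: the PACE lever θ* unused by any born node before this one); HOME =
run/shared/lean/pub/decomp-ns); TREE node N9 (root-closing file UNDER N1
route-NavierStokesRegularity-RootDecompTerminalEnergy: it keeps N1's items P2 NoEnergyAtom 24827, J1
AtomFreeBlowupIsTame 24829, P1 NoTypeIBlowup 1217 BY SIGNATURE
(dedup) and REPLACES N1's residual E₂ 24828 by D₁ ∧ E₂″; `--refines
route-…-RootDecompTerminalEnergy` is the honest parent pointer once that gate flag exists).
TREE: ROOT `NavierStokesRegularity` (Clay (A)) ⟸[N1's closes, landed frame NoBlowup ⟺ S] P2 ∧ J1 ∧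
E₂ ∧ P1, and E₂ ⟸[KERNEL, this node] D₁ CoherentPacedExtends
(crux r2, ATTACKABLE NOW) ∧ E₂″ TameWildIsTypeI (crux r3, DECLARED RESIDUAL); banked aside PZ
AlignedPaceZoom (PZ ⟹ D₁ kernel; the one prover target of the
line). It suffices to show X = P2 ∧ D₁ ∧ E₂″ ∧ J1 ∧ P1 with D₁ = «a classical Leray–Hopf solution on
[0,T) from a rapidly decaying datum whose vorticity
direction is uniformly sine-continuous on {|ω| > d} (anti-parallel allowed) and whose speed is PACED
by its vorticity (sup|u|² ≤ C(1 + sup|ω(t)|) along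
t ↑ T) extends past T» and E₂″ = «a TAME first blow-up (u(t) → u(T) in L²) whose core is NOT
coherent (ballistic or incoherent) is Type I». Why this is
novel: no route of the census (COSTUME-CENSUS-v2.json sha256
05830338dcd56dc85a60276b05d4c6d88311c06479f2f16e07487067c2455ac6) and no born node meets the
ALIGNMENT seam
(ContinuousAlignment 18584) with the PACE seam (VorticityPace 7779 / line `pace`) under the ROOT:
W2's own route closes through its Tao-loaded a-priori
residual W1 18585, VorticityPace through (L); here the meet is booked through N1/E₂ and at the meet
the engine is two LANDED theorems (1923 + bounded
continuation), so the special cell is removed ENGINE-FREE — the first refinement of E₂ with an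
attackable piece and a strictly smaller residual.
Lean: `NoEnergyAtom ∧ CoherentPacedExtends ∧ TameWildIsTypeI ∧ AtomFreeBlowupIsTame ∧ NoTypeIBlowup`

## Assembly
Pure logic (kernel-checked, 0 sorry): N1's deciding chain (no blow-up ⟸ P1 after E₂ after J1 after
P2, through `Theorems.navierStokesRegularity_of_noBlowup`)
with E₂ produced in-line from D₁ ∧ E₂″ by excluded middle on «coherent core» (coherent ⟹ D₁ says the
solution extends, contradicting maximality; wild ⟹ E₂″).

Rationale: WHY THIS LINE. N1 (RootDecompTerminalEnergy) reduced Clay (A) to four blow-up-conditional statements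
of which E₂ «tame first blow-ups are Type I» is the residual of
record. The lens cuts E₂ by the STRUCTURE OF THE CORE: coherent (vortex lines locally
(anti-)parallel at some vorticity level — the hypothesis of crux
W2 = 18584 verbatim — AND paced — line `pace`'s form verbatim, = bounded core Reynolds number ι*² =
U*²/(νΩ), VorticityPace's θ* ↛ 0) versus wild. On
the coherent cell the blow-up argument runs WITHOUT a rate: pace + unboundedness give a KNSS §6 zoom
to a bounded ancient mild solution carrying a
vorticity certificate (PaceZoom, PROVED on route VorticityPace as 7781's bridge), the same-time
alignment modulus makes the limit UNIDIRECTIONAL, and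
unidirectional bounded ancient mild solutions are constant — LANDED
(`Theorems.stub_unidirectionalLiouville`, stmt-1923, p173853); bounded solutions extend
(`hasSmoothExtensionPast_of_bounded_holds`, PROVED). So D₁ = Giga–Miura 2011 Thm 1.1
(doi:10.1007/s00220-011-1197-x) with the TYPE-I RATE replaced by PACE —
not in print (GM11, Giga–Hsu–Maekawa 2014, GGH19 doi:10.1016/j.na.2019.111579
[corpus:paper-doi-10-1016-j-na-2019-111579 p.3], Barker–Prange 2020 arXiv:1906.08225
all assume Type I; Beirão da Veiga–Berselli need Hölder-½ direction regularity) and attackable with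
every analytic input in tree. The generic cell E₂″ (wild
core: ballistic νΩ = o(U*²) — Tao's cascade, NSI pastings — or incoherent — Hou's swirl,
Moffatt–Kimura skew reconnection) is the new residual, strictly
below E₂ (kernel restriction; separating class = tame coherent-core Type-II collapse, excluded
nowhere in print). Imported area: blow-up/compactness/Liouville
machinery (KNSS 2009) + geometric depletion (Constantin–Fefferman direction coherence) met at a
rate-free criterion; census §8 names PACE as the one lever no
born node had used (N7 now uses it at near-misses; this node uses it on the blow-up orbit itself,
cut by alignment).

RANKED CRUXES. #2 CoherentPacedExtends (crux) — COHERENT PACED CORES EXTEND (D₁; predicates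
IsSineAligned / KeepsPace INLINED verbatim from the lens = W2's hypothesis and line `pace`'s form)
[tag WEAKER(evidence: S ⟹ D₁ by vacuity through NoBlowup; W2 = 18584 ⟹ D₁ by one added hypothesis,
kernel `coherentPacedExtends_of_W2`; separating class vs S = every incoherent or ballistic blow-up,
on which D₁ is silent) · ATTACKABLE NOW (critic rows 25/27: size L, (L)-FREE — PZ ⟹ D₁ kernel over
LANDED 1923 + PROVED bounded continuation; PZ = registered provable-class stub of line `pace`) ·
Tao-free, NSI-free (a conditional criterion)]. A classical Leray–Hopf solution on ℝ³ × [0,T) from a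
rapidly decaying datum, sine-aligned at some vorticity level d > 0 uniformly on [0,T) and paced,
extends smoothly past T. [difficulty: L] (why it might fail: the same-time alignment modulus at
FIXED physical scale may not survive the pace zoom uniformly enough to force one direction e for all
times of the limit (slices with ω ≡ 0, direction drift e(t)); GM11 needed the Type-I rate exactly to
control the zoom.) [doi:10.1007/s00220-011-1197-x, doi:10.1016/j.na.2019.111579, arXiv:1906.08225,
arXiv:0709.3599]
#3 TameWildIsTypeI (crux) — TAME WILD-CORE BLOW-UP IS TYPE I (E₂″, the NEW RESIDUAL; ¬IsCoherentCore
INLINED) [tag DECLARED RESIDUAL · WEAKER than E₂ = stmt-24828 (restriction, kernel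
`tameWild_of_noTameTypeII`; strictly: UNDECIDED-consistent — separating class tame coherent-core
Type-II collapse) · S-necessary (vacuity) · BARRIER inside: Tao-LOADED (the averaged cascade is
ballistic) and NSI-LOADED (Ożański's NSI blow-up is a velocity pasting) exactly as E₂ · IDEA-NEEDED
· INSTRUMENTABLE (pace ratio θ* and sine-modulus on Hou's data; census)]. A maximal smooth
Leray–Hopf solution from a rapidly decaying datum with first blow-up at T, tame (u(t) → u(T) in L²),
whose core is not coherent (not both aligned-at-a-level and paced), blows up at the Type-I rate.
[difficulty: open-problem] (why it might fail: = why E₂ might fail on the generic cell: a tame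
Type-II blow-up with a ballistic (Tao-cascade-like) or swirling incoherent (Hou-like) core realised
by a Schwartz datum of the true equation.) [arXiv:1402.0290, arXiv:2107.06509, arXiv:0709.3599,
Fefferman2000]
#4 NoEnergyAtom (crux) — NO TERMINAL ENERGY ATOM (P2 = N1's item stmt-24827 VERBATIM, dedup by
signature) [tag inherited from N1 (its tags of record: crux r2 there); DECLARED RESIDUAL for this
node's tribunal reading (not attacked here)]. At a first blow-up time the energy measure |u(t)|²dx
develops no Dirac atom: for every point, lim sup of the local energy in balls B(x₀,r) near T tends
to 0 with r. [difficulty: open-problem] (why it might fail: a collapsing self-focusing core could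
carry a fixed quantum of energy into a point (energy-supercritical concentration is not excluded by
CKN-type partial regularity, which bounds only the parabolic 1-measure of the singular set).)
[arXiv:0709.3599, arXiv:1402.0290, Fefferman2000]
#5 AtomFreeBlowupIsTame (crux) — ATOM-FREE FIRST BLOW-UPS ARE TAME (J1 = N1's item stmt-24829
VERBATIM, dedup) [tag inherited from N1; DECLARED RESIDUAL here (not attacked)]. A maximal smooth
Leray–Hopf solution with no terminal energy atom is tame: u(t) → u(T) in L² as t ↑ T. [difficulty:
M] (why it might fail: energy could escape to spatial infinity or oscillate without concentrating
(no atom, yet no strong L² limit) — tameness needs a tightness argument that the energy inequality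
alone may not give at the blow-up time.) [arXiv:1705.04420, arXiv:0709.3599]
#6 NoTypeIBlowup (crux) — NO TYPE-I BLOW-UP (P1 = stmt-1217 VERBATIM, dedup; the summit's Type-I
residual of record) [tag inherited; DECLARED RESIDUAL here; B1-hard; proved rungs: axisymmetric
(KNSS), λ-DSS near 1 (Chae–Wolf), small Type-I constant]. [difficulty: open-problem] (why it might
fail: a backward discretely self-similar profile realised from Schwartz data (Leray's scenario
survives in the DSS class; only λ near 1, axisymmetric and small-constant cases are excluded).)
[arXiv:0709.3599, arXiv:1811.00502, NecasRuzickaSverak1996]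
#9 AlignedPaceZoom (support) — ALIGNED PACE ZOOM (PZ; ASIDE — banked, NOT in the cone of `closes`:
PZ ⟹ D₁ is kernel (`coherentPacedExtends_of_alignedPaceZoom` in the lens and in Sketch.lean) and PZ
is the registered stub `stub_paceZoom` of line `pace`
(Cruxes/ContinuousAlignmentCriterion/Lines/pace.lean:57) VERBATIM up to unfolding — filed so the
statement is tree-visible and stampable; the ONE prover target of D₁'s line) [tag aside · provable
class (KNSS §6 compactness with two passengers: pace certificate and alignment modulus; size L)].
Aligned + paced + unbounded ⟹ a non-constant UNIDIRECTIONAL bounded ancient mild solution (smooth,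
gradient-bounded, curl v(t,x) ∥ e). [difficulty: L] (why it might fail: as D₁ — the alignment
modulus must pass to the zoom at every pair of rescaled points and yield ONE direction for all
times.) [arXiv:0709.3599, doi:10.1007/s00220-011-1197-x]

TWO-LAYER PLAN. No split filed at birth. Beneath D₁ (BC3 skeleton, not items): stub_alignedPaceZoom
(= PZ, L, load-bearing) + stub_boundedContinuation (bounded classical
Leray–Hopf solutions extend — LANDED as `hasSmoothExtensionPast_of_bounded_holds`; kept as a named
stub only to expose the case split) ⟹ `CoherentPacedExtends_of`
(kernel, with the LANDED unidirectional Liouville theorem 1923). E₂″ is met by lens-2 g3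
ColumnarCoreDichotomy (CLEARED row 39: E₂″ ⟺ C₂ ∧ E₂‴) and can be
MET with lens-6 g2 PaceGaugeMeet's R*-form residual — tenure material (glued splits), not items now.

KILL CRITERIA. (i) a tame coherent-core (aligned + paced) blow-up from Schwartz data refutes D₁ and
decides (C); (ii) PZ refuted (an aligned paced unbounded family whose
every zoom limit is constant or not unidirectional) kills the LINE — D₁ then needs W2-type input
(retag IDEA-NEEDED); (iii) census: θ* → 0 (ballistic) AND
sine-modulus failing on every instrumented candidate (Hou, Kerr, cascade) makes the coherent cell
physically thin — keep D₁ as a bankable criterion, demote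
staffing; (iv) E₂″/P1/P2/J1 are residuals of record (any tame Type-II wild-core, Type-I, or
atom-carrying blow-up from Schwartz data kills them and (A)).

NOT DECOMPOSED YET. E₂″ (residual; its g3 cut ColumnarCoreDichotomy is CLEARED and books under this
node), P1/P2/J1 (N1's, untouched). The exactness lemmas (`noTameTypeII_iff_cells`,
`node_iff`, `*_of_root`) live in the lens file; the writer ships a kernel-checked Exactness record
against the born decls as route evidence.

CHEAPEST FALSIFIER. Lookup (lens 2026-08-30, corpus fts+hybrid+vec and galaxy; writer re-read): is a
RATE-FREE direction-coherence criterion (alignment + pace, no Type I) in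
print? — GM11 / GHM14 / GGH19 / BP20 all assume Type I; Beirão da Veiga–Berselli 2002 need Hölder ½;
no hit for «vorticity direction» ∧ «without Type I» beyond
these. Second cheapest (census, minutes): θ* and the sine-modulus along Hou's 2022 axis data and the
K9 anti-parallel runs — decides which cell the known
candidates populate (informative either way).

DEFINITION REQUESTS. None: IsClassicalNSSolutionOn, IsLerayHopfOn, HasRapidSpatialDecay,
HasSmoothExtensionPast, IsMaximalSmoothSolution, IsTypeIBlowup, curl,
IsBoundedAncientMildSolution exist (Sketch.lean rc 0); IsSineAligned / KeepsPace / IsCoherentCore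
are INLINED (defeq to the lens forms; dedup `Iff.rfl`
against N1's three items checked in Sketch.lean).

Novelty: Searches (lens 2026-08-30, re-read by the writer): lit search --hybrid «vorticity direction
regularity criterion without Type I pace»; lit vsearch «blow-up
argument with vorticity direction coherence and no rate assumption»; lit galaxy search «vorticity
direction|Giga-Miura|type I» --star all; ledger negatives;
rg over Theses/*.lean for IsSineAligned|KeepsPace|paceZoom (ContinuousAlignment, VorticityPace,
Cruxes/ContinuousAlignmentCriterion/Lines/pace.lean only).
Nearest prior art found: GM11 doi:10.1007/s00220-011-1197-x Thm 1.1 (Type I + continuous alignment ⟹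
regular); GGH19 [corpus:paper-doi-10-1016-j-na-2019-111579
p.3]; Barker–Prange 2020 [corpus:arxiv-1906.08225]; KNSS arXiv:0709.3599 §6 (the zoom); in tree:
crux 18584 (W2) and its line `pace` (stub_paceZoom +
stub_unidirectionalLiouville LANDED), VorticityPace 7779/7781/7782, N1.
Delta: the alignment seam and the pace seam are MET under the root through N1's residual E₂, making
the special cell's engine two landed theorems
(rate-free Giga–Miura) and leaving a strictly smaller, typed generic residual E₂″ — a combination no
route or node books.
Claimed grade: new-combination  [refs: 10.1007/s00220-011-1197-x, 0709.3599, doi:10.1007/s00220-011-1197-x, paper-doi-10-1016-j-na-2019-111579, arxiv-1906.08225]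

Barriers (technique_class: blow-up compactness, Liouville, vorticity direction): - technique_class: blow-up compactness, Liouville, vorticity direction
- Literature.Barriers.NavierStokesRegularity.EnergySupercriticality: D₁ OUTSIDE — it spends two
scale-invariant STRUCTURAL hypotheses (pace = bounded core
  Reynolds number, alignment modulus) on compactness + rigidity, never an energy-class a-priori
bound; E₂″/P1/P2/J1 INSIDE (declared residuals).
- Literature.Barriers.NavierStokesRegularity.TaoAveragedBlowup: D₁/PZ OUTSIDE (conditional criteria;
the averaged cascade is ballistic — θ* → 0 — so D₁ is
  vacuous on it); E₂″ Tao-LOADED (declared, as E₂).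
- Literature.Barriers.NavierStokesRegularity.AveragedTypeIBlowup: bites P1 (inherited residual, must
use exact-equation structure); D₁ does not exclude
  Type I abstractly — its rigidity step is the LANDED unidirectional Liouville theorem (strong
maximum principle / harmonicity of ∂₃v, exact equation).
- Literature.Barriers.NavierStokesRegularity.NSITypeIIBlowup: D₁ outside the NSI class (mild zoom
limits, vorticity direction, Liouville use the equation);
  E₂″ NSI-LOADED (declared).
- Literature.Barriers.NavierStokesRegularity.VortexStretchingAprioriBounds: not in play — no
a-priori vortex-stretching bound is claimed; alignment is a
  HYPOTHESIS on the solution class (Constantin–Fefferman type), licensed by the blow-up argument as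
Type I licensed GM11.
- Literature.Barriers.NavierStokesRegularity.CompactPerturbationRigidity: not engaged (no
perturbative rigidity of a profile; the Liouville statement is globa

sub-problem: NavierStokesRegularity · status: open · opened planner-decomp-ns-writer-1-g2-0 2026-08-30T04:22:56Z · rev 0 · ledger route-NavierStokesRegularity-RootDecompAlignedCore
GENERATED by the gate from the ledger (D-0016/17). Provers cite these decls: `theorem foo : Summit.NavierStokesRegularity.NavierStokesRegularity.Theses.RootDecompAlignedCore.<Decl> := …` in Summits/NavierStokesRegularity/NavierStokesRegularity/Theorems/<Name>.lean.
-/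

namespace Summit.NavierStokesRegularity.NavierStokesRegularity.Theses.RootDecompAlignedCore

open scoped BigOperators Topology Manifold Classical MeasureTheory ProbabilityTheory Matrix InnerProductSpace ComplexConjugate ContinuousMap
open Filter Set Function TopologicalSpace MeasureTheory

attribute [summit_statement] _root_.NavierStokesRegularity

open Literature.NS

/-- item stmt-NavierStokesRegularity-27619 · crux · rank 2 · open · by planner
why it might fail: the same-time alignment modulus at FIXED physical scale may not survive the pace zoom uniformly enough to force one direction e for all times of the limit (slices with ω ≡ 0, direction drift e(t)); GM11 needed the Type-I rate exactly to control the zoom.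
sources: doi:10.1007/s00220-011-1197-x, doi:10.1016/j.na.2019.111579, arXiv:1906.08225, arXiv:0709.3599
[crux] COHERENT PACED CORES EXTEND (D₁; predicates IsSineAligned / KeepsPace INLINED verbatim from
the lens = W2's hypothesis and line `pace`'s form) [tag WEAKER(evidence: S ⟹ D₁ by vacuity through
NoBlowup; W2 = 18584 ⟹ D₁ by one added hypothesis, kernel `coherentPacedExtends_of_W2`; separating
class vs S = every incoherent or ballistic blow-up, on which D₁ is silent) · ATTACKABLE NOW (critic
rows 25/27: size L, (L)-FREE — PZ ⟹ D₁ kernel over LANDED 1923 + PROVED bounded continuation; PZ =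
registered provable-class stub of line `pace`) · Tao-free, NSI-free (a conditional criterion)]. A
classical Leray–Hopf solution on ℝ³ × [0,T) from a rapidly decaying datum, sine-aligned at some
vorticity level d > 0 uniformly on [0,T) and paced, extends smoothly past T. [difficulty: L] -/
@[route_item "route-NavierStokesRegularity-RootDecompAlignedCore", crux]
def CoherentPacedExtends : Prop :=
  ∀ (ν T : ℝ), 0 < ν → 0 < T → ∀ (u : ℝ → EuclideanSpace ℝ (Fin 3) → EuclideanSpace ℝ (Fin 3)) (p : ℝ → EuclideanSpace ℝ (Fin 3) → ℝ), Literature.Analysis.FluidPDE.IsClassicalNSSolutionOn (Set.Ico 0 T) ν 0 u p → Literature.Analysis.FluidPDE.IsLerayHopfOn T ν 0 (u 0) u → Literature.Analysis.FluidPDE.HasRapidSpatialDecay (u 0) → ∀ d : ℝ, 0 < d → (∀ ε : ℝ, 0 < ε → ∃ δ : ℝ, 0 < δ ∧ ∀ t ∈ Set.Ico 0 T, ∀ x y : EuclideanSpace ℝ (Fin 3), d < ‖Literature.Analysis.FluidPDE.curl (u t) x‖ → d < ‖Literature.Analysis.FluidPDE.curl (u t) y‖ → ‖x - y‖ < δ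 → Real.sqrt (1 - (inner ℝ (‖Literature.Analysis.FluidPDE.curl (u t) x‖⁻¹ • Literature.Analysis.FluidPDE.curl (u t) x) (‖Literature.Analysis.FluidPDE.curl (u t) y‖⁻¹ • Literature.Analysis.FluidPDE.curl (u t) y)) ^ 2) ≤ ε) → (∃ C : ℝ, ∀ t₀ ∈ Set.Ico 0 T, ∃ t ∈ Set.Ico t₀ T, ∀ s ∈ Set.Icc 0 t, ∀ x : EuclideanSpace ℝ (Fin 3), ∃ y : EuclideanSpace ℝ (Fin 3), ‖u s x‖ ^ 2 ≤ C * (1 + ‖Literature.Analysis.FluidPDE.curl (u t) y‖)) → Literature.Analysis.FluidPDE.HasSmoothExtensionPast ν 0 u T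

/-- item stmt-NavierStokesRegularity-27620 · crux · rank 3 · open · by planner
why it might fail: = why E₂ might fail on the generic cell: a tame Type-II blow-up with a ballistic (Tao-cascade-like) or swirling incoherent (Hou-like) core realised by a Schwartz datum of the true equation.
sources: arXiv:1402.0290, arXiv:2107.06509, arXiv:0709.3599, Fefferman2000
[crux] TAME WILD-CORE BLOW-UP IS TYPE I (E₂″, the NEW RESIDUAL; ¬IsCoherentCore INLINED) [tag
DECLARED RESIDUAL · WEAKER than E₂ = stmt-24828 (restriction, kernel `tameWild_of_noTameTypeII`;
strictly: UNDECIDED-consistent — separating class tame coherent-core Type-II collapse) · S-necessary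
(vacuity) · BARRIER inside: Tao-LOADED (the averaged cascade is ballistic) and NSI-LOADED (Ożański's
NSI blow-up is a velocity pasting) exactly as E₂ · IDEA-NEEDED · INSTRUMENTABLE (pace ratio θ* and
sine-modulus on Hou's data; census)]. A maximal smooth Leray–Hopf solution from a rapidly decaying
datum with first blow-up at T, tame (u(t) → u(T) in L²), whose core is not coherent (not both
aligned-at-a-level and paced), blows up at the Type-I rate. [difficulty: open-problem] -/
@[route_item "route-NavierStokesRegularity-RootDecompAlignedCore", crux]
def TameWildIsTypeI : Prop :=
  ∀ (ν T : ℝ), 0 < ν → 0 < T → ∀ (u : ℝ → EuclideanSpace ℝ (Fin 3) → EuclideanSpace ℝ (Fin 3)) (p : ℝ → EuclideanSpace ℝ (Fin 3) → ℝ), Literature.Analysis.FluidPDE.IsMaximalSmoothSolution ν 0 u p T → Literature.Analysis.FluidPDE.IsLerayHopfOn T ν 0 (u 0) u → Literature.Analysis.FluidPDE.HasRapidSpatialDecay (u 0) → Filter.Tendsto (fun t => MeasureTheory.eLpNorm (u t - u T) 2 MeasureTheory.volume) (nhdsWithin T (Set.Iio T)) (nhds 0) → ¬ ((∃ d : ℝ,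 0 < d ∧ (∀ ε : ℝ, 0 < ε → ∃ δ : ℝ, 0 < δ ∧ ∀ t ∈ Set.Ico 0 T, ∀ x y : EuclideanSpace ℝ (Fin 3), d < ‖Literature.Analysis.FluidPDE.curl (u t) x‖ → d < ‖Literature.Analysis.FluidPDE.curl (u t) y‖ → ‖x - y‖ < δ → Real.sqrt (1 - (inner ℝ (‖Literature.Analysis.FluidPDE.curl (u t) x‖⁻¹ • Literature.Analysis.FluidPDE.curl (u t) x) (‖Literature.Analysis.FluidPDE.curl (u t) y‖⁻¹ • Literature.Analysis.FluidPDE.curl (u t) y)) ^ 2) ≤ ε)) ∧ (∃ C : ℝ, ∀ t₀ ∈ Set.Ico 0 T, ∃ t ∈ Set.Ico t₀ T, ∀ s ∈ Set.Icc 0 t, ∀ x : EuclideanSpace ℝ (Fin 3), ∃ y : EuclideanSpace ℝ (Fin 3), ‖u s x‖ ^ 2 ≤ C * (1 + ‖Literature.Analysis.FluidPDE.curl (u t) y‖))) → Literature.Analysis.FluidPDE.IsTypeIBlowup u T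

/-- item stmt-NavierStokesRegularity-24827 · crux · rank 4 · open · by planner
why it might fail: a collapsing self-focusing core could carry a fixed quantum of energy into a point (energy-supercritical concentration is not excluded by CKN-type partial regularity, which bounds only the parabolic 1-measure of the singular set).
sources: arXiv:0709.3599, arXiv:1402.0290, Fefferman2000
[crux] P2 — NO ENERGY ATOM AT A FRAME TIME [the ATTACKED cell; = registered stub `stub_noEnergyAtom`
of crux stmt-19625 (Cruxes/WeakLambdaCriterion/Lines/birth.lean) VERBATIM, reused not re-invented;
tag WEAKER(evidence: 0056 ⇒ P2 KERNEL `noEnergyAtom_of_typeIIEnergyEquality`; S ⇒ P2 KERNEL (critic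
`noEnergyAtom_of_root`, writer `noEnergyAtom_of_noBlowup`); in-NS separating classes where P2 is a
THEOREM: rate β<3/5 `leslieShvydkoy2018_noConcentration_of_rate`, Type I
`noEnergyAtom_of_isTypeIBlowup`, enstrophy α<4/5 `noEnergyAtom_of_enstrophyRate` — critic CLEARED
2026-08-30T01:32:55Z, CRITIC-LEDGER row 7); leaf ATTACKABLE-by-inheritance (LS18/CKN engine; open =
LS18 Question 1.1 at dimension 0, arXiv:1705.04420 p.4) + INSTRUMENTABLE (exponent test: an atom
needs sup-rate β ≥ 3/5 and core radius γ ≤ 2β/3; Tao band test); BC5 rung LANDED: Type-I case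
`Theorems.NoTerminalJolt.noEnergyAtom_of_isTypeIBlowup`]: a classical NS solution on ℝ³×[0,T) (zero
force), Leray–Hopf on [0,T] from its rapidly decaying datum, deposits no energy atom at time T: ∀x₀
∀η>0 ∃r>0, ∫_{B_r(x₀)}|u(t)|² < η for all t<T close to T. [difficulty: open-problem] -/
@[route_item "route-NavierStokesRegularity-RootDecompAlignedCore", crux]
def NoEnergyAtom : Prop :=
  ∀ (ν T : ℝ), 0 < ν → 0 < T → ∀ (u : ℝ → EuclideanSpace ℝ (Fin 3) → EuclideanSpace ℝ (Fin 3)) (p : ℝ → EuclideanSpace ℝ (Fin 3) → ℝ), Literature.Analysis.FluidPDE.IsClassicalNSSolutionOn (Set.Ico 0 T) ν 0 u p → Literature.Analysis.FluidPDE.IsLerayHopfOn T ν 0 (u 0) u → Literature.Analysis.FluidPDE.HasRapidSpatialDecay (u 0) → ∀ (x₀ : EuclideanSpace ℝ (Fin 3)) (η : NNReal), 0 < η → ∃ r : ℝ, 0 < r ∧ ∀ᶠ t in nhdsWithin T (Set.Iio T), ∫⁻ x in Metric.ball x₀ r, ‖u t x‖ₑ ^ 2 < (η : ENNReal)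

/-- item stmt-NavierStokesRegularity-24829 · crux · rank 5 · open · by planner
why it might fail: energy could escape to spatial infinity or oscillate without concentrating (no atom, yet no strong L² limit) — tameness needs a tightness argument that the energy inequality alone may not give at the blow-up time.
sources: arXiv:1705.04420, arXiv:0709.3599
[crux] J1 — AN ATOM-FREE FIRST BLOW-UP IS TAME [lens-2 J1 VERBATIM; RESIDUAL diffuse-dust cell; tag
WEAKER(evidence: E₁/18118 ⇒ J1 trivially, 0056 ⇒ J1 kernel via LS18 Thm 1.2 landed; separating
classes: atomic collapses and tame Type-II spikes, alive; omitted cell never constructed even in the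
NSI relaxation — Scheffer/Ożański cascades are defect-free); leaf IDEA-NEEDED (GMT of the energy
measure on the compact 𝓗¹-null singular slice Σ_T + dynamics; no named engine) — critic CLEARED
2026-08-30T01:32:55Z row 7 as the middle cell]: a maximal smooth solution with lifespan T,
Leray–Hopf from a rapidly decaying datum, which deposits no energy atom at T, has ‖u(t) − u(T)‖_{L²}
→ 0 as t ↑ T (NS cannot smear a positive energy quantum over an uncountable 𝓗¹-null dust). [deps:
NoEnergyAtom] [difficulty: open-problem] -/
@[route_item "route-NavierStokesRegularity-RootDecompAlignedCore", crux]
def AtomFreeBlowupIsTame : Prop :=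
  ∀ (ν T : ℝ), 0 < ν → 0 < T → ∀ (u : ℝ → EuclideanSpace ℝ (Fin 3) → EuclideanSpace ℝ (Fin 3)) (p : ℝ → EuclideanSpace ℝ (Fin 3) → ℝ), Literature.Analysis.FluidPDE.IsMaximalSmoothSolution ν 0 u p T → Literature.Analysis.FluidPDE.IsLerayHopfOn T ν 0 (u 0) u → Literature.Analysis.FluidPDE.HasRapidSpatialDecay (u 0) → (∀ (x₀ : EuclideanSpace ℝ (Fin 3)) (η : NNReal), 0 < η → ∃ r : ℝ, 0 < r ∧ ∀ᶠ t in nhdsWithin T (Set.Iio T), ∫⁻ x in Metric.ball x₀ r, ‖u t x‖ₑ ^ 2 < (η : ENNReal)) → Filter.Tendsto (fun t => MeasureTheory.eLpNorm (u t - u T) 2 MeasureTheory.volume) (nhdsWithin T (Set.Iio T)) (nhds 0)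

/-- item stmt-NavierStokesRegularity-1217 · crux · rank 6 · open · by planner
why it might fail: a backward discretely self-similar profile realised from Schwartz data (Leray's scenario survives in the DSS class; only λ near 1, axisymmetric and small-constant cases are excluded).
sources: arXiv:0709.3599, arXiv:1811.00502, NecasRuzickaSverak1996
[target] X = NO TYPE-I BLOW-UP FOR CLAY DATA: a classical solution of unforced NS on ℝ³×[0,T) which
is Leray–Hopf from a rapidly decaying datum and blows up at most at the Type-I rate ‖u(t)‖∞ ≤
C(T−t)^{-1/2} extends smoothly past T. Equals UnthreadedNoBlowup ∧ ThreadedNoBlowup by excluded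
middle on 'every point is unthreaded' (proved in the planner's Sketch.lean: target_of_cruxes); it is
the unconditional conclusion of stmt-NavierStokesRegularity-0058 (route TypeILiouville, which
assumes (L)). With NoTypeII (stmt-0056) it gives NoBlowup (stmt-0054). Card:
threading-flux-trace-topology. -/
@[route_item "route-NavierStokesRegularity-RootDecompAlignedCore", crux]
def NoTypeIBlowup : Prop :=
  ∀ (ν T : ℝ), 0 < ν → 0 < T → ∀ (u : ℝ → EuclideanSpace ℝ (Fin 3) → EuclideanSpace ℝ (Fin 3)) (p : ℝ → EuclideanSpace ℝ (Fin 3) → ℝ), Literature.Analysis.FluidPDE.IsClassicalNSSolutionOn (Set.Ico 0 T) ν 0 u p → Literature.Analysis.FluidPDE.IsLerayHopfOn T ν 0 (u 0) u → Literature.Analysis.FluidPDE.HasRapidSpatialDecay (u 0) → Literature.Analysis.FluidPDE.IsTypeIBlowup u T → Literature.Analysis.FluidPDE.HasSmoothExtensionPast ν 0 u T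

/-- item stmt-NavierStokesRegularity-27621 · aside · rank 9 · open · by planner
why it might fail: as D₁ — the alignment modulus must pass to the zoom at every pair of rescaled points and yield ONE direction for all times.
sources: arXiv:0709.3599, doi:10.1007/s00220-011-1197-x
[support] ALIGNED PACE ZOOM (PZ; ASIDE — banked, NOT in the cone of `closes`: PZ ⟹ D₁ is kernel
(`coherentPacedExtends_of_alignedPaceZoom` in the lens and in Sketch.lean) and PZ is the registered
stub `stub_paceZoom` of line `pace` (Cruxes/ContinuousAlignmentCriterion/Lines/pace.lean:57)
VERBATIM up to unfolding — filed so the statement is tree-visible and stampable; the ONE prover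
target of D₁'s line) [tag aside · provable class (KNSS §6 compactness with two passengers: pace
certificate and alignment modulus; size L)]. Aligned + paced + unbounded ⟹ a non-constant
UNIDIRECTIONAL bounded ancient mild solution (smooth, gradient-bounded, curl v(t,x) ∥ e).
[difficulty: L] -/
@[route_item "route-NavierStokesRegularity-RootDecompAlignedCore"]
def AlignedPaceZoom : Prop :=
  ∀ (ν T : ℝ), 0 < ν → 0 < T → ∀ (u : ℝ → EuclideanSpace ℝ (Fin 3) → EuclideanSpace ℝ (Fin 3)) (p : ℝ → EuclideanSpace ℝ (Fin 3) → ℝ), Literature.Analysis.FluidPDE.IsClassicalNSSolutionOn (Set.Ico 0 T) ν 0 u p → Literature.Analysis.FluidPDE.IsLerayHopfOn T ν 0 (u 0) u → Literature.Analysis.FluidPDE.HasRapidSpatialDecay (u 0) → ∀ d : ℝ, 0 < d → (∀ ε : ℝ, 0 < ε → ∃ δ : ℝ, 0 < δ ∧ ∀ t ∈ Set.Ico 0 T, ∀ x y : EuclideanSpace ℝ (Fin 3), d < ‖Literature.Analysis.FluidPDE.curl (u t) x‖ → d < ‖Literature.Analysis.FluidPDE.curl (u t) y‖ → ‖x - y‖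 < δ → Real.sqrt (1 - (inner ℝ (‖Literature.Analysis.FluidPDE.curl (u t) x‖⁻¹ • Literature.Analysis.FluidPDE.curl (u t) x) (‖Literature.Analysis.FluidPDE.curl (u t) y‖⁻¹ • Literature.Analysis.FluidPDE.curl (u t) y)) ^ 2) ≤ ε) → (∃ C : ℝ, ∀ t₀ ∈ Set.Ico 0 T, ∃ t ∈ Set.Ico t₀ T, ∀ s ∈ Set.Icc 0 t, ∀ x : EuclideanSpace ℝ (Fin 3), ∃ y : EuclideanSpace ℝ (Fin 3), ‖u s x‖ ^ 2 ≤ C * (1 + ‖Literature.Analysis.FluidPDE.curl (u t) y‖)) → (¬ ∃ M : ℝ, ∀ t ∈ Set.Ico 0 T, ∀ x : EuclideanSpace ℝ (Fin 3), ‖u t x‖ ≤ M) → ∃ (v : ℝ → EuclideanSpace ℝ (Fin 3) → EuclideanSpace ℝ (Fin 3)) (e : EuclideanSpace ℝ (Fin 3)), ‖e‖ = 1 ∧ Literature.Analysis.FluidPDE.IsBoundedAncientMildSolution 1 v ∧ ContDiffOn ℝ (⊤ : ℕ∞) (Function.uncurry v) (Set.Iio 0 ×ˢ Set.univ) ∧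 (∃ C : ℝ, ∀ t < 0, ∀ x, ‖fderiv ℝ (v t) x‖ ≤ C) ∧ (∀ t < 0, ∀ x, ∃ c : ℝ, Literature.Analysis.FluidPDE.curl (v t) x = c • e) ∧ ¬ (∀ t < 0, ∀ x y, v t x = v t y)

/-- item stmt-NavierStokesRegularity-27622 · assembly · rank 1 · open · by planner
sources: Fefferman2000, arXiv:0709.3599
[assembly] the implication the glue proves: P2 → D₁ → E₂″ → J1 → P1 → Clay (A). -/
@[route_item "route-NavierStokesRegularity-RootDecompAlignedCore"]
def Assembly : Prop :=
  NoEnergyAtom → CoherentPacedExtends → TameWildIsTypeI → AtomFreeBlowupIsTame → NoTypeIBlowup → NavierStokesRegularity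

/-! D-0027 §2.1 — DECIDING THEOREM (planner-authored via `route open/edit --closes-file`; by planner-decomp-ns-writer-1-g2-0 2026-08-30T04:22:56Z):
its hypotheses are this route's items and its conclusion the sub-problem Statement (glue_lint), and it elaborates with this file. -/

@[closes "route-NavierStokesRegularity-RootDecompAlignedCore"] theorem closes (hA : NoEnergyAtom) (hD : CoherentPacedExtends) (hW : TameWildIsTypeI)
    (hJ : AtomFreeBlowupIsTame) (hI : NoTypeIBlowup) : NavierStokesRegularity := by
  refine Summit.NavierStokesRegularity.NavierStokesRegularity.Theorems.navierStokesRegularity_of_noBlowup ?_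
  intro ν T hν hT u p hcl hLH hdec
  by_contra hext
  have hmax : Literature.Analysis.FluidPDE.IsMaximalSmoothSolution ν 0 u p T := ⟨hcl, hext⟩
  have htame := hJ ν T hν hT u p hmax hLH hdec (hA ν T hν hT u p hcl hLH hdec)
  refine hext (hI ν T hν hT u p hcl hLH hdec ?_)
  refine (Classical.em _).elim (fun hK => ?_) (hW ν T hν hT u p hmax hLH hdec htame)
  obtain ⟨⟨d, hd, hal⟩, hpace⟩ := hK
  exact absurd (hD ν T hν hT u p hcl hLH hdec d hd hal hpace) hext

end Summit.NavierStokesRegularity.NavierStokesRegularity.Theses.RootDecompAlignedCore
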